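import Summits.HodgeConjecture.HodgeConjecture.Theorems.F0P5TP2StubR2Engine
import HarnessLib

/-!
# Crux `HLiu418`, K-lane sub-line `F0_P5TP2SpectralProjection` — stub **(R₂)**, ASSEMBLY HALF (generic rank `N`, one place `w₁`, any odd
# continuous chart `e : ℂ → U(σ_{w₁}J)(ℂ)`): the representative `Ψ(x) = ∫ A(u) w̄(x sec(u)) dν(u)` and its six `Realises₁` properties

Cell hodgecm-mathlib (D-0151), FLOOR 0, programme P5 (Alb-CM), crux item `HLiu418` = stmt-HodgeConjecture-24832; K-lane sub-line
`Cruxes/HLiu418/Lines/F0_P5TP2SpectralProjection.lean` (skeleton v0 by A-p14 (g16), sha16 ce659ab5fe57535c), stub **(R₂) `stub_R₂ :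
StubR₂RegularOfReproduced`** (hand A-p04 (g21)).  THEOREMS ONLY; `--supports stmt-HodgeConjecture-24832 --as helper`.  HC_CM is proved only modulo
the 7 printed citations until rung 0 closes; this file proves nothing about them.  Middle file of three: ★ `Theorems/F0P5TP2StubR2Engine` (§0–§2:
invariant representatives, good points, continuity of orbital integrals) → THIS (§3: (R1)–(R6) for the explicit `Ψ`, `exists_realises`) →
`Theorems/F0P5TP2StubR2` (the CM closer `stubR₂_holds`).

SETTING as in the engine (`U := archLocal E N J w₁` with binders `[MeasurableSpace U] [BorelSpace U]`, Haar `ν`, `sec := adelicSingle w₁`,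
`K_c := (ker archAt w₁).map archToAdelic` compact, automorphic `μ`), plus an ODD CONTINUOUS CHART `e : ℂ → U` (`e (−z) = (e z)⁻¹`; at the
sub-line `e = γ`, `γ z = exp (X z)`) and a scalar kernel `A` on `U`, continuous, compactly supported, `C¹` along the left probes `z ↦ A (e z · u′)`
with jointly continuous probe derivative (the four fields of the skeleton's `IsRegularKernel₁`).  For an EXACTLY `K_c K_f`-invariant `L²` function `w̄`
(engine §1) with every base point good (engine §2), the orbital integral **`Ψ(x) := ∫ A(u) w̄(x sec(u)) dν(u)`** satisfies:
(R1) left `A_G·G(K)`-invariance (★ `orbitalIntegral_mul_left`); (R2) continuity on `U(J)(𝔸_F)` (engine `continuous_orbitalIntegral_of_invariant`);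
(R3) `toQuotFun Ψ = w` a.e. when `w = ∫ A(u) • R(sec u) w dν` (★ `coeFn_integral_smul_rightRegular_toLp_eq_orbitalIntegral`); (R4)∕(R5)
differentiable probes `z ↦ Ψ(y sec(e z))` with derivatives continuous in `y` (A-p02 (g18)'s ★ `AutomorphicFormsL2OrbitalSmoothingChart`:
`hasFDerivAt_orbitalIntegral_chart`, `fderiv_orbitalIntegral_chart_apply` — the derivative is the orbital integral against the derivative kernel, to
which (R2) applies); (R6) the probe derivatives REPRESENT the `L²`-derivative of `z ↦ R(sec (e z)) w` at `0` (★
`fderiv_rightRegular_chart_integral_smul_apply` + the Fubini representative of the smoothed class).  `exists_realises` assembles (R1)–(R6) from the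
`K_c K_f`-invariance of `w` and the reproduction.  The one-coordinate port of ★ `Theorems/F0P2dStubR` §3 (F0P2-p04 (g2), rank 3).

## References
* [Borel1997] A. Borel, *Automorphic forms on SL₂(ℝ)*, Cambridge Tracts 130 (1997), Thm. 2.13–2.14 and §8.4, §5.14.
* [HarishChandra1966] Harish-Chandra, *Discrete series for semisimple Lie groups II*, Acta Math. 116 (1966), §8 (`φ = φ ∗ α`).
* [BorelJacquet1979] A. Borel, H. Jacquet, Corvallis PSPM 33.1 (1979), §4.1–4.2, §4.6.
-/

set_option autoImplicit false
-- the mandated namespace has the single-problem summit's repeated segment (`HodgeConjecture.HodgeConjecture`)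
set_option linter.dupNamespace false

noncomputable section

namespace Summit.HodgeConjecture.HodgeConjecture.Cruxes.HLiu418.F0P5TP2StubR2Psi

open scoped Topology ENNReal Pointwise Matrix ComplexOrder
open MeasureTheory NumberField NumberField.InfinitePlace Set Filter Function
open Literature.NumberTheory.Automorphic Literature.NumberTheory.Automorphic.UnitaryGroup
open Literature.NumberTheory.Automorphic.UnitaryGroup.CotangentForms (toQuotFun toQuotFun_mk)
open Literature.NumberTheory.Automorphic.OrbitalSmoothingChart
open Summit.HodgeConjecture.HodgeConjecture.Cruxes.HLiu418.F0P5TP2StubR2Engine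

/-! ## §3 The representative `Ψ(x) = ∫ A(u) w̄(x sec(u)) dν(u)` and its six `Realises₁` properties (generic rank `N`, one place `w₁`) -/

section Assembly

variable (F E : Type) [Field F] [NumberField F] [Field E] [NumberField E] [Algebra F E]
  (c : E ≃ₐ[F] E) (N : ℕ) (J : Matrix (Fin N) (Fin N) E) (hc : c ≠ 1) (hfix : ∀ w : InfinitePlace E, c • w = w)
  (w₁ : {w : InfinitePlace E // IsComplex w})
  (μ : Measure (adelicGroupData F E c N J).automorphicQuotient) [(adelicGroupData F E c N J).IsAutomorphicMeasure μ]
  [MeasurableSpace (archLocal E N J w₁)] [BorelSpace (archLocal E N J w₁)] (ν : Measure (archLocal E N J w₁)) [ν.IsHaarMeasure]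
  {e : ℂ → archLocal E N J w₁} (A : archLocal E N J w₁ → ℂ) (Fv : (adelicGroupData F E c N J).automorphicQuotient → ℂ)

omit [(adelicGroupData F E c N J).IsAutomorphicMeasure μ] [BorelSpace (archLocal E N J w₁)] [ν.IsHaarMeasure] in
/-- (R1) **`Ψ` is left-`A_G · G(K)`-invariant** (at every point). [cite: BorelJacquet1979, §4.2] -/
theorem psi_mul_left {γ : (adelicGroupData F E c N J).Adelic} (hγ : γ ∈ (adelicGroupData F E c N J).quotientSubgroup)
    (x : (adelicGroupData F E c N J).Adelic) :
    (∫ u, A u * invQuot (adelicGroupData F E c N J) Fv (γ * x * adelicSingle F E c N J hc hfix w₁ u) ∂ν) =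
      ∫ u, A u * invQuot (adelicGroupData F E c N J) Fv (x * adelicSingle F E c N J hc hfix w₁ u) ∂ν :=
  (adelicGroupData F E c N J).orbitalIntegral_mul_left ν A Fv hγ x

omit [(adelicGroupData F E c N J).IsAutomorphicMeasure μ] in
/-- (R2) **`Ψ` is continuous on `U(J)(𝔸_F)`** (engine §2). [cite: Borel1997, Thm. 2.13 and §8.4] -/
theorem continuous_psi (hAc : Continuous A) (hAs : HasCompactSupport A) {Kf : Subgroup (finAdelic F E c N J)}
    (hKfo : IsOpen (Kf : Set (finAdelic F E c N J)))
    (hgood : ∀ x : (adelicGroupData F E c N J).Adelic,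
      LocallyIntegrable (fun u : archLocal E N J w₁ ↦ invQuot (adelicGroupData F E c N J) Fv (x * adelicSingle F E c N J hc hfix w₁ u)) ν)
    (hFc : ∀ k ∈ ((archAt F E c N J w₁ (hfix w₁.1) hc).ker).map (archToAdelic F E c N J), ∀ ξ, Fv (k • ξ) = Fv ξ)
    (hFf : ∀ k ∈ Kf, ∀ ξ, Fv (finAdelicToAdelic F E c N J k • ξ) = Fv ξ) :
    Continuous fun x : (adelicGroupData F E c N J).Adelic ↦
      ∫ u, A u * invQuot (adelicGroupData F E c N J) Fv (x * adelicSingle F E c N J hc hfix w₁ u) ∂ν :=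
  continuous_orbitalIntegral_of_invariant F E c N J hc hfix w₁ ν hKfo hgood hFc hFf hAc hAs

omit [BorelSpace (archLocal E N J w₁)] [ν.IsHaarMeasure] in
/-- (R3) **The class of `Ψ` is `w`**: `toQuotFun Ψ = w` a.e., from the reproduction `w = ∫ A(u) • R(sec u) w dν` and the Fubini representative of the
smoothed class (★ `coeFn_integral_smul_rightRegular_toLp_eq_orbitalIntegral`). [cite: BorelJacquet1979, §4.6] [cite: Borel1997, Thm. 2.13] -/
theorem toQuotFun_psi_ae_eq [BorelSpace (archLocal E N J w₁)] [ν.IsHaarMeasure] (hAc : Continuous A) (hAs : HasCompactSupport A)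
    (w : (adelicGroupData F E c N J).L2 μ) (hFmem : MemLp Fv 2 μ) (hFw : hFmem.toLp Fv = w)
    (hrep : (∫ u, A u • (adelicGroupData F E c N J).rightRegular μ (adelicSingle F E c N J hc hfix w₁ u) w ∂ν) = w) :
    toQuotFun (adelicGroupData F E c N J)
        (fun x ↦ ∫ u, A u * invQuot (adelicGroupData F E c N J) Fv (x * adelicSingle F E c N J hc hfix w₁ u) ∂ν) =ᵐ[μ]
      ((w : (adelicGroupData F E c N J).L2 μ) : (adelicGroupData F E c N J).automorphicQuotient → ℂ) := by
  haveI := secondCountableTopology_archLocal E N J w₁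
  haveI := locallyCompactSpace_archLocal E N J w₁
  have hι : Continuous (adelicSingle F E c N J hc hfix w₁) := continuous_adelicSingle F E c N J hc hfix w₁
  have hleft : ∀ γ ∈ (adelicGroupData F E c N J).quotientSubgroup, ∀ x,
      (fun x ↦ ∫ u, A u * invQuot (adelicGroupData F E c N J) Fv (x * adelicSingle F E c N J hc hfix w₁ u) ∂ν) (γ * x) =
        (fun x ↦ ∫ u, A u * invQuot (adelicGroupData F E c N J) Fv (x * adelicSingle F E c N J hc hfix w₁ u) ∂ν) x :=
    fun γ hγ x ↦ psi_mul_left F E c N J hc hfix w₁ ν A Fv hγ x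
  have hcls := (adelicGroupData F E c N J).coeFn_integral_smul_rightRegular_toLp_eq_orbitalIntegral μ ν hι hAc hAs hFmem
  rw [hFw, hrep] at hcls
  filter_upwards [hcls] with y hy
  obtain ⟨x, rfl⟩ : ∃ x, (adelicGroupData F E c N J).toAutomorphicQuotient x = y := QuotientGroup.mk_surjective y
  rw [toQuotFun_mk hleft x, hy x rfl]

omit [(adelicGroupData F E c N J).IsAutomorphicMeasure μ] in
/-- (R4) **The probes of `Ψ` through an odd continuous chart `e` are differentiable at every point**, with derivative the pointwise derivative
integral (★ `hasFDerivAt_orbitalIntegral_chart`, at every good base point — here every base point). [cite: Borel1997, Thm. 2.13] -/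
theorem hasFDerivAt_probe_psi (he : Continuous e) (he_neg : ∀ b, e (-b) = (e b)⁻¹) (hAc : Continuous A) (hAs : HasCompactSupport A)
    (hAd : ∀ u' : archLocal E N J w₁, ContDiff ℝ 1 fun z : ℂ ↦ A (e z * u'))
    (hAD : Continuous fun p : ℂ × archLocal E N J w₁ ↦ fderiv ℝ (fun z : ℂ ↦ A (e z * p.2)) p.1)
    (hgood : ∀ x : (adelicGroupData F E c N J).Adelic,
      LocallyIntegrable (fun u : archLocal E N J w₁ ↦ invQuot (adelicGroupData F E c N J) Fv (x * adelicSingle F E c N J hc hfix w₁ u)) ν)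
    (y : (adelicGroupData F E c N J).Adelic) (b₀ : ℂ) :
    HasFDerivAt (fun z : ℂ ↦ ∫ u, A u * invQuot (adelicGroupData F E c N J) Fv
        (y * adelicSingle F E c N J hc hfix w₁ (e z) * adelicSingle F E c N J hc hfix w₁ u) ∂ν)
      (∫ u, invQuot (adelicGroupData F E c N J) Fv (y * adelicSingle F E c N J hc hfix w₁ u) •
        fderiv ℝ (fun b' : ℂ ↦ A ((e b')⁻¹ * u)) b₀ ∂ν) b₀ := by
  haveI := secondCountableTopology_archLocal E N J w₁
  haveI := locallyCompactSpace_archLocal E N J w₁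
  exact (adelicGroupData F E c N J).hasFDerivAt_orbitalIntegral_chart ν he he_neg hAc hAs hAd hAD Fv (hgood y) b₀

omit [(adelicGroupData F E c N J).IsAutomorphicMeasure μ] in
/-- (R4′) **The probe derivative of `Ψ`, evaluated**: `∂_z|_{b₀} Ψ(y sec(e z)) · v = ∫ (D_z|_{b₀} A((e z)⁻¹u) · v) w̄(y sec u) dν` — again an orbital
integral of `w̄`, against the derivative kernel. [cite: Borel1997, Thm. 2.13] -/
theorem fderiv_probe_psi_apply (he : Continuous e) (he_neg : ∀ b, e (-b) = (e b)⁻¹) (hAc : Continuous A) (hAs : HasCompactSupport A)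
    (hAd : ∀ u' : archLocal E N J w₁, ContDiff ℝ 1 fun z : ℂ ↦ A (e z * u'))
    (hAD : Continuous fun p : ℂ × archLocal E N J w₁ ↦ fderiv ℝ (fun z : ℂ ↦ A (e z * p.2)) p.1)
    (hgood : ∀ x : (adelicGroupData F E c N J).Adelic,
      LocallyIntegrable (fun u : archLocal E N J w₁ ↦ invQuot (adelicGroupData F E c N J) Fv (x * adelicSingle F E c N J hc hfix w₁ u)) ν)
    (y : (adelicGroupData F E c N J).Adelic) (b₀ v : ℂ) :
    fderiv ℝ (fun z : ℂ ↦ ∫ u, A u * invQuot (adelicGroupData F E c N J) Fv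
        (y * adelicSingle F E c N J hc hfix w₁ (e z) * adelicSingle F E c N J hc hfix w₁ u) ∂ν) b₀ v =
      ∫ u, fderiv ℝ (fun b' : ℂ ↦ A ((e b')⁻¹ * u)) b₀ v *
        invQuot (adelicGroupData F E c N J) Fv (y * adelicSingle F E c N J hc hfix w₁ u) ∂ν := by
  haveI := secondCountableTopology_archLocal E N J w₁
  haveI := locallyCompactSpace_archLocal E N J w₁
  exact (adelicGroupData F E c N J).fderiv_orbitalIntegral_chart_apply ν he he_neg hAc hAs hAd hAD Fv (hgood y) b₀ v

omit [(adelicGroupData F E c N J).IsAutomorphicMeasure μ] in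
/-- (R5) **The probe derivatives are continuous in the base point** (they are orbital integrals of the exactly invariant `w̄` against the continuous
compactly supported derivative kernels, so (R2) applies). [cite: Borel1997, Thm. 2.13 and §8.4] -/
theorem continuous_fderiv_probe_psi (he : Continuous e) (he_neg : ∀ b, e (-b) = (e b)⁻¹) (hAc : Continuous A) (hAs : HasCompactSupport A)
    (hAd : ∀ u' : archLocal E N J w₁, ContDiff ℝ 1 fun z : ℂ ↦ A (e z * u'))
    (hAD : Continuous fun p : ℂ × archLocal E N J w₁ ↦ fderiv ℝ (fun z : ℂ ↦ A (e z * p.2)) p.1)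
    {Kf : Subgroup (finAdelic F E c N J)} (hKfo : IsOpen (Kf : Set (finAdelic F E c N J)))
    (hgood : ∀ x : (adelicGroupData F E c N J).Adelic,
      LocallyIntegrable (fun u : archLocal E N J w₁ ↦ invQuot (adelicGroupData F E c N J) Fv (x * adelicSingle F E c N J hc hfix w₁ u)) ν)
    (hFc : ∀ k ∈ ((archAt F E c N J w₁ (hfix w₁.1) hc).ker).map (archToAdelic F E c N J), ∀ ξ, Fv (k • ξ) = Fv ξ)
    (hFf : ∀ k ∈ Kf, ∀ ξ, Fv (finAdelicToAdelic F E c N J k • ξ) = Fv ξ) (v : ℂ) :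
    Continuous fun y : (adelicGroupData F E c N J).Adelic ↦ fderiv ℝ (fun z : ℂ ↦ ∫ u, A u * invQuot (adelicGroupData F E c N J) Fv
        (y * adelicSingle F E c N J hc hfix w₁ (e z) * adelicSingle F E c N J hc hfix w₁ u) ∂ν) 0 v := by
  have h : Continuous fun y : (adelicGroupData F E c N J).Adelic ↦ ∫ u, fderiv ℝ (fun b' : ℂ ↦ A ((e b')⁻¹ * u)) 0 v *
      invQuot (adelicGroupData F E c N J) Fv (y * adelicSingle F E c N J hc hfix w₁ u) ∂ν :=
    continuous_orbitalIntegral_of_invariant F E c N J hc hfix w₁ ν hKfo hgood hFc hFf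
      (continuous_fderiv_comp_chart_inv_mul_apply he_neg hAd hAD 0 v)
      (hasCompactSupport_fderiv_comp_chart_inv_mul_apply he hAs 0 v)
  exact h.congr fun y ↦ (fderiv_probe_psi_apply F E c N J hc hfix w₁ ν A Fv he he_neg hAc hAs hAd hAD hgood y 0 v).symm

omit [BorelSpace (archLocal E N J w₁)] [ν.IsHaarMeasure] in
/-- (R6, `L²` side) **The orbit map of the reproduced class `w` through the chart is differentiable at `0`**, with derivative in direction `v` the class
smoothed by the derivative kernel: `∂_z|_0 R(sec (e z)) w · v = ∫ (∂_z|_0 A((e z)⁻¹ u) · v) • R(sec u) w dν`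
(★ `fderiv_rightRegular_chart_integral_smul_apply`). [cite: HarishChandra1966, §8] [cite: Borel1997, Thm. 2.13] -/
theorem fderiv_orbit_apply [BorelSpace (archLocal E N J w₁)] [ν.IsHaarMeasure] (he : Continuous e) (he_neg : ∀ b, e (-b) = (e b)⁻¹)
    (hAc : Continuous A) (hAs : HasCompactSupport A)
    (hAd : ∀ u' : archLocal E N J w₁, ContDiff ℝ 1 fun z : ℂ ↦ A (e z * u'))
    (hAD : Continuous fun p : ℂ × archLocal E N J w₁ ↦ fderiv ℝ (fun z : ℂ ↦ A (e z * p.2)) p.1)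
    (w : (adelicGroupData F E c N J).L2 μ)
    (hrep : (∫ u, A u • (adelicGroupData F E c N J).rightRegular μ (adelicSingle F E c N J hc hfix w₁ u) w ∂ν) = w) (v : ℂ) :
    fderiv ℝ (fun z : ℂ ↦ (adelicGroupData F E c N J).rightRegular μ (adelicSingle F E c N J hc hfix w₁ (e z)) w) 0 v =
      ∫ u, fderiv ℝ (fun b' : ℂ ↦ A ((e b')⁻¹ * u)) 0 v •
        (adelicGroupData F E c N J).rightRegular μ (adelicSingle F E c N J hc hfix w₁ u) w ∂ν := by
  haveI := secondCountableTopology_archLocal E N J w₁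
  haveI := locallyCompactSpace_archLocal E N J w₁
  have hι : Continuous (adelicSingle F E c N J hc hfix w₁) := continuous_adelicSingle F E c N J hc hfix w₁
  have horb : (fun z : ℂ ↦ (adelicGroupData F E c N J).rightRegular μ (adelicSingle F E c N J hc hfix w₁ (e z)) w) =
      fun z ↦ (adelicGroupData F E c N J).rightRegular μ (adelicSingle F E c N J hc hfix w₁ (e z))
        (∫ u, A u • (adelicGroupData F E c N J).rightRegular μ (adelicSingle F E c N J hc hfix w₁ u) w ∂ν) := by
    funext z; rw [hrep]
  rw [horb]
  exact (adelicGroupData F E c N J).fderiv_rightRegular_chart_integral_smul_apply μ ν he he_neg hι hAc hAs hAd hAD w v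

/-- (R6) **The probe derivatives REPRESENT the `L²`-derivatives**: `toQuotFun (y ↦ ∂_z|_0 Ψ(y sec(e z)) · v)` agrees a.e. with the class
`∂_z|_0 R(sec (e z)) w · v` — both are «`w̄` smoothed by the derivative kernel `u ↦ ∂A · v`», read pointwise resp. in `L²` (two Fubini
representatives; ★ `coeFn_integral_smul_rightRegular_toLp_eq_orbitalIntegral`). [cite: HarishChandra1966, §8] [cite: Borel1997, Thm. 2.13] -/
theorem toQuotFun_fderiv_probe_psi_ae_eq (he : Continuous e) (he_neg : ∀ b, e (-b) = (e b)⁻¹) (hAc : Continuous A) (hAs : HasCompactSupport A)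
    (hAd : ∀ u' : archLocal E N J w₁, ContDiff ℝ 1 fun z : ℂ ↦ A (e z * u'))
    (hAD : Continuous fun p : ℂ × archLocal E N J w₁ ↦ fderiv ℝ (fun z : ℂ ↦ A (e z * p.2)) p.1)
    (w : (adelicGroupData F E c N J).L2 μ) (hFmem : MemLp Fv 2 μ) (hFw : hFmem.toLp Fv = w)
    (hrep : (∫ u, A u • (adelicGroupData F E c N J).rightRegular μ (adelicSingle F E c N J hc hfix w₁ u) w ∂ν) = w)
    (hgood : ∀ x : (adelicGroupData F E c N J).Adelic,
      LocallyIntegrable (fun u : archLocal E N J w₁ ↦ invQuot (adelicGroupData F E c N J) Fv (x * adelicSingle F E c N J hc hfix w₁ u)) ν)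
    (v : ℂ) :
    toQuotFun (adelicGroupData F E c N J) (fun y ↦ fderiv ℝ (fun z : ℂ ↦ ∫ u, A u * invQuot (adelicGroupData F E c N J) Fv
        (y * adelicSingle F E c N J hc hfix w₁ (e z) * adelicSingle F E c N J hc hfix w₁ u) ∂ν) 0 v) =ᵐ[μ]
      ((fderiv ℝ (fun z : ℂ ↦ (adelicGroupData F E c N J).rightRegular μ (adelicSingle F E c N J hc hfix w₁ (e z)) w) 0 v :
        (adelicGroupData F E c N J).L2 μ) : (adelicGroupData F E c N J).automorphicQuotient → ℂ) := by
  haveI := secondCountableTopology_archLocal E N J w₁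
  haveI := locallyCompactSpace_archLocal E N J w₁
  have hι : Continuous (adelicSingle F E c N J hc hfix w₁) := continuous_adelicSingle F E c N J hc hfix w₁
  -- the pointwise side is the orbital integral against the derivative kernel, which is left-invariant
  have hpt : (fun y ↦ fderiv ℝ (fun z : ℂ ↦ ∫ u, A u * invQuot (adelicGroupData F E c N J) Fv
        (y * adelicSingle F E c N J hc hfix w₁ (e z) * adelicSingle F E c N J hc hfix w₁ u) ∂ν) 0 v) =
      fun y ↦ ∫ u, fderiv ℝ (fun b' : ℂ ↦ A ((e b')⁻¹ * u)) 0 v *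
        invQuot (adelicGroupData F E c N J) Fv (y * adelicSingle F E c N J hc hfix w₁ u) ∂ν :=
    funext fun y ↦ fderiv_probe_psi_apply F E c N J hc hfix w₁ ν A Fv he he_neg hAc hAs hAd hAD hgood y 0 v
  have hleft : ∀ γ ∈ (adelicGroupData F E c N J).quotientSubgroup, ∀ x,
      (fun y ↦ ∫ u, fderiv ℝ (fun b' : ℂ ↦ A ((e b')⁻¹ * u)) 0 v *
        invQuot (adelicGroupData F E c N J) Fv (y * adelicSingle F E c N J hc hfix w₁ u) ∂ν) (γ * x) =
      (fun y ↦ ∫ u, fderiv ℝ (fun b' : ℂ ↦ A ((e b')⁻¹ * u)) 0 v *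
        invQuot (adelicGroupData F E c N J) Fv (y * adelicSingle F E c N J hc hfix w₁ u) ∂ν) x :=
    fun γ hγ x ↦ (adelicGroupData F E c N J).orbitalIntegral_mul_left ν _ Fv hγ x
  -- the `L²` side is the smoothed class
  have hL2 := fderiv_orbit_apply F E c N J hc hfix w₁ μ ν A he he_neg hAc hAs hAd hAD w hrep v
  have hcls := (adelicGroupData F E c N J).coeFn_integral_smul_rightRegular_toLp_eq_orbitalIntegral μ ν hι
    (continuous_fderiv_comp_chart_inv_mul_apply he_neg hAd hAD 0 v)
    (hasCompactSupport_fderiv_comp_chart_inv_mul_apply he hAs 0 v) hFmem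
  rw [hFw] at hcls
  rw [hpt, hL2]
  filter_upwards [hcls] with y hy
  obtain ⟨x, rfl⟩ : ∃ x, (adelicGroupData F E c N J).toAutomorphicQuotient x = y := QuotientGroup.mk_surjective y
  rw [toQuotFun_mk hleft x, hy x rfl]

/-- **(R1)–(R6) ASSEMBLED (generic rank `N`, one place `w₁`, odd continuous chart `e`).**  If `K_c` is compact, a `K_c K_f`-invariant `L²` class
`w` (`K_f` open) reproduced by a regular kernel, `∫ A(u) • R(sec u) w dν = w`, has a representative `Ψ` with the six `Realises₁` properties in the
order `leftInv, cont, aeEq, diff, contDeriv, derivAe`. [cite: Borel1997, Thm. 2.13 and §8.4] [cite: HarishChandra1966, §8] [cite: BorelJacquet1979, §4.1–4.2] -/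
theorem exists_realises
    (hKc : IsCompact (((archAt F E c N J w₁ (hfix w₁.1) hc).ker).map (archToAdelic F E c N J) : Set (adelicGroupData F E c N J).Adelic))
    (he : Continuous e) (he_neg : ∀ b, e (-b) = (e b)⁻¹) (hAc : Continuous A) (hAs : HasCompactSupport A)
    (hAd : ∀ u' : archLocal E N J w₁, ContDiff ℝ 1 fun z : ℂ ↦ A (e z * u'))
    (hAD : Continuous fun p : ℂ × archLocal E N J w₁ ↦ fderiv ℝ (fun z : ℂ ↦ A (e z * p.2)) p.1)
    (w : (adelicGroupData F E c N J).L2 μ)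
    (hrep : (∫ u, A u • (adelicGroupData F E c N J).rightRegular μ (adelicSingle F E c N J hc hfix w₁ u) w ∂ν) = w)
    (hkc : ∀ k ∈ ((archAt F E c N J w₁ (hfix w₁.1) hc).ker).map (archToAdelic F E c N J), (adelicGroupData F E c N J).rightRegular μ k w = w)
    (hkf : ∃ Kf : Subgroup (finAdelic F E c N J), IsOpen (Kf : Set (finAdelic F E c N J)) ∧
      ∀ k ∈ Kf, (adelicGroupData F E c N J).rightRegular μ (finAdelicToAdelic F E c N J k) w = w) :
    ∃ Ψ : (adelicGroupData F E c N J).Adelic → ℂ,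
      (∀ γ ∈ (adelicGroupData F E c N J).quotientSubgroup, ∀ x, Ψ (γ * x) = Ψ x) ∧
      Continuous Ψ ∧
      toQuotFun (adelicGroupData F E c N J) Ψ =ᵐ[μ] ((w : (adelicGroupData F E c N J).L2 μ) : (adelicGroupData F E c N J).automorphicQuotient → ℂ) ∧
      (∀ y, DifferentiableAt ℝ (fun z : ℂ ↦ Ψ (y * adelicSingle F E c N J hc hfix w₁ (e z))) 0) ∧
      (∀ z : ℂ, Continuous fun y ↦ fderiv ℝ (fun z : ℂ ↦ Ψ (y * adelicSingle F E c N J hc hfix w₁ (e z))) 0 z) ∧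
      (∀ z : ℂ, toQuotFun (adelicGroupData F E c N J) (fun y ↦ fderiv ℝ (fun z : ℂ ↦ Ψ (y * adelicSingle F E c N J hc hfix w₁ (e z))) 0 z) =ᵐ[μ]
        ((fderiv ℝ (fun z : ℂ ↦ (adelicGroupData F E c N J).rightRegular μ (adelicSingle F E c N J hc hfix w₁ (e z)) w) 0 z :
          (adelicGroupData F E c N J).L2 μ) : (adelicGroupData F E c N J).automorphicQuotient → ℂ)) := by
  obtain ⟨Kf, hKfo, hKf⟩ := hkf
  -- shrink the open `K_f` to a compact open one
  set Kf' : Subgroup (finAdelic F E c N J) := Kf ⊓ finAdelicIntegralLevel F E c N J with hKf'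
  have hKf'o : IsOpen (Kf' : Set (finAdelic F E c N J)) := by
    rw [hKf', Subgroup.coe_inf]
    exact hKfo.inter (isOpen_finAdelicIntegralLevel _ _ _ _ _)
  have hKf'c : IsCompact (Kf' : Set (finAdelic F E c N J)) := by
    rw [hKf', Subgroup.coe_inf]
    exact (isCompact_finAdelicIntegralLevel _ _ _ _ _).inter_left (Subgroup.isClosed_of_isOpen Kf hKfo)
  have hKf'w : ∀ k ∈ Kf', (adelicGroupData F E c N J).rightRegular μ (finAdelicToAdelic F E c N J k) w = w :=
    fun k hk ↦ hKf k (Subgroup.mem_inf.1 hk).1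
  -- an exactly invariant representative
  obtain ⟨Fw, hFm, ⟨hFmem, hFw⟩, hFc, hFf⟩ :=
    exists_invariant_representative F E c N J hc hfix w₁ hKc μ Kf' hKf'c w hkc hKf'w
  have hFi : Integrable Fw μ := hFmem.integrable one_le_two
  have hgood : ∀ x : (adelicGroupData F E c N J).Adelic,
      LocallyIntegrable (fun u : archLocal E N J w₁ ↦ invQuot (adelicGroupData F E c N J) Fw (x * adelicSingle F E c N J hc hfix w₁ u)) ν :=
    fun x ↦ locallyIntegrable_orbitFun_of_invariant' F E c N J hc hfix w₁ μ ν hKf'o hFm hFi hFc hFf x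
  refine ⟨fun x ↦ ∫ u, A u * invQuot (adelicGroupData F E c N J) Fw (x * adelicSingle F E c N J hc hfix w₁ u) ∂ν,
    ?_, ?_, ?_, ?_, ?_, ?_⟩
  · exact fun γ hγ x ↦ psi_mul_left F E c N J hc hfix w₁ ν A Fw hγ x
  · exact continuous_psi F E c N J hc hfix w₁ ν A Fw hAc hAs hKf'o hgood hFc hFf
  · exact toQuotFun_psi_ae_eq F E c N J hc hfix w₁ μ ν A Fw hAc hAs w hFmem hFw hrep
  · exact fun y ↦ (hasFDerivAt_probe_psi F E c N J hc hfix w₁ ν A Fw he he_neg hAc hAs hAd hAD hgood y 0).differentiableAt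
  · exact fun z ↦ continuous_fderiv_probe_psi F E c N J hc hfix w₁ ν A Fw he he_neg hAc hAs hAd hAD hKf'o hgood hFc hFf z
  · exact fun z ↦ toQuotFun_fderiv_probe_psi_ae_eq F E c N J hc hfix w₁ μ ν A Fw he he_neg hAc hAs hAd hAD w hFmem hFw hrep hgood z

end Assembly


end Summit.HodgeConjecture.HodgeConjecture.Cruxes.HLiu418.F0P5TP2StubR2Psi

end
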